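import Summits.BirchSwinnertonDyer.BirchSwinnertonDyer.Theorems.EisensteinPrimesMazurMCOnCellBTwistbackTwoStepShaUnitLevel
import Summits.BirchSwinnertonDyer.BirchSwinnertonDyer.Theorems.SchneiderFreeAdditiveX3PoitouTateSelmerDualityHolds
import Summits.BirchSwinnertonDyer.BirchSwinnertonDyer.Theorems.SchneiderFreeAdditiveX3PoitouTateShaDualityHolds
import Summits.BirchSwinnertonDyer.BirchSwinnertonDyer.Theorems.EisensteinPrimesMazurMCOnCellBTwistbackUnitEndCell70971a1
import Summits.BirchSwinnertonDyer.BirchSwinnertonDyer.Theorems.Rank2ShaTierKitW16P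
import Summits.BirchSwinnertonDyer.BirchSwinnertonDyer.Theorems.EisensteinPrimesMazurMCOnCellBTwistbackUnitEndP5Cell395c1
import Summits.BirchSwinnertonDyer.BirchSwinnertonDyer.Theorems.EisensteinPrimesMazurMCOnCellBTwistbackUnitEndP7Cell546f1Base
import Summits.BirchSwinnertonDyer.Rank1Residual.X1.DoubleTwistDisplayKit
import Summits.BirchSwinnertonDyer.Rank1Residual.X2.RouteGSplitDisplay329718a1Local
import Summits.BirchSwinnertonDyer.Rank1Residual.X2.TwistParityStability
import Literature.NumberTheory.EllipticCurves.TateCurve.NumberFieldUniformization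
import Literature.NumberTheory.EllipticCurves.TateCurve.NumberFieldUniformizationTwisted
import Literature.NumberTheory.EllipticCurves.HeegnerHypothesisKroneckerProofs
import Literature.NumberTheory.EllipticCurves.HeegnerFieldOfDiscriminantProofs
import Literature.NumberTheory.EllipticCurves.ModularityVersionApProofs
import Literature.NumberTheory.EllipticCurves.MazurTorsionGaloisStructureProofs
import Mathlib.Tactic.NormNum.LegendreSymbol
import HarnessLib

/-!
# Crux 3 `MazurMCOnCellB` (stmt-BirchSwinnertonDyer-19033), line `twistback` v12 — ROAD (e) «TWO-STEP Ш-UNIT» DISPLAYED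
# AT A PRIME `p = 7`: the SPLIT X2b pair `(20510e1, 7)` (`20510e1 = [1, -1, 1, 9588, 2333199]`, `N = 20510 = 2·5·7·293`) — a road-(e) display of the
# line outside the `p = 3` atlas A10 (EVEN half of the w5 ∕ w8 standing cut); every decidable side condition in the kernel; two admissible fields
# `ℚ(√-31)`, `ℚ(√-271)` and FOUR instrument readings

Width seat bsd-line-x2-p1-w8 (g6) under the STANDING CUT with bsd-line-x2-p1-w5 (g5) (bus 03:50:21Z) — GENERATOR = x2-p1-w5 g5's
`gen_pP.py` (format, proofs and tools are w5 g5's; only the cell, the path and the readings are this seat's run of w5's local engine v2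
`cellp.py`, kit 0), cell `bsd-eis` (run/shared/lean/pub/bsd-eis/), 2026-08-29; `--supports stmt-BirchSwinnertonDyer-19033
--as helper`. THEOREMS ONLY (no `def`, no named fact introduced, no `sorry`, no instance); format of w5 g3/g4's
`…UnitEndCell<label>` files, base facts in-file as in `…UnitEndCell279150d1` ; the transport lemma `exists_addOrderOf_eq_of_curve_eq` of w5 g5's
`…UnitEndP5Cell395c1` (p691901) REUSED BY NAME. WHY: the crux quantifies over ALL primes `p`; every
per-pair display on file sits at `p = 3` (A10); the two-step closer `mazurMainConjectureAt_of_cellB_of_twoStepShaUnit_of_levels` (w6 g2)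
and `X2.not_gvPar_of_nsmul_eq_zero_of_mult` are `p`-generic and cell b2b-bsdr2sha's `Rank2Sha.fiveTorsCheck` certifies a rational point
of order `7` in the kernel, so the road opens verbatim at `p = 7` (first opened by w5 g5's p695701 on `546f1`); this file is the cell `20510e1` of that population.

WHAT. `20510e1 = [1, -1, 1, 9588, 2333199]` (Cremona: class `20510e` = {`20510e1`; `20510e2 = [1, -1, 1, -5545962, -5028652761]`}, isogeny matrix `[[1, 7], [7, 1]]`, kernel certificate
`EisensteinPrimesP7IsogenyCertificates01.isIsogenous_20510e1_20510e2`; `r = 0`, `#T = 7`, `∏c = 343`, `L(E,1) = 2.41020235`, `Ω = 0.34431462`, `L/Ω = 7 = 343·#Ш/49`,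
`#Ш_an = 1`) is the reduced minimal model of the Kubert–Tate curve `[11, 140, 3500, 0, 0]` (shift `⟨1,-57,-5,-1436⟩`): `N = 20510 = 2·5·7·293` (second (after w5 g5's 546f1) conductor of w5 g5’s scan `cands_30000.log`), `|Δ| = 2⁷·5⁷·7⁷·293`, `c₄ = -460239`;
SPLIT multiplicative at `2`, `5`, `7` (node-tangent root `t = 1` mod `7`), NON-split at `293`; rational point `T = (57, 1721)` of ORDER `7`
(`2T = (-83, -939)`, `4T = (407, 8371)`, `8T = T`; three `intTangent` certificates), hence `E[7]` reducible and `¬ GVPar (E, 7)`; `c_2 = 7`, `c_5 = 7`, `c_7 = 7`, `c_293 = 1`; root number `+1`.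
`2 ∣ N` ⇒ admissible `d ≡ 1 (mod 8)`: 2 admissible paths with `D ≤ 10000`, 1 rank-0 ends, 1 of them `7`-adic units (`#Ш_an ∈ {1}`), no non-unit rank-0 end.
* FIRST STEP `K = ℚ(√-31)`: `-31 ≡ 1 (mod 8)`, `(-31/q) = +1` for `q ∈ {5, 7, 293}`; the partner
  `Wd = 20510e1 ⊗ χ_{-31} = [1, -1, 1, 9214368, -69582054269]` (globally minimal, PROVED; `⟨1, -8, 1 / 2, 1 / 2⟩⁻¹ • Wd =
  20510e1.quadraticTwist (-31)`, PROVED) has root number `−1` and — READING — `L′(Wd, 1) = 42.0936233 ≠ 0`.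
* SECOND STEP `K″ = ℚ(√-271)` : `-271 ≡ 1 (mod 8)`, `(-271/q) = +1` for `q ∈ {5, 7, 293, 31}`; the double twist
  `W″ = Wd ⊗ χ_{-271} = 20510e1 ⊗ χ_{8401} = [1, -1, 1, 676712423238, 1384811584041302649]` (globally minimal, PROVED; `⟨1, -68, 1 / 2, 1 / 2⟩⁻¹ • W″ =
  Wd.quadraticTwist (-271)`, PROVED) has — READINGS — `L(W″, 1) = 5.153996089 ≠ 0` and `#Ш_an(W″) = 1` (L(W″,1)/Ω(W″) = 1372.000 = #Ш·(∏c(E)·∏_{q∣D} c_q)/#W″(ℚ)_tors² = #Ш·343·2·2/1²), a `7`-adic unit.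
* `X2.CellB (20510e1) 5` from the rank reading; good reduction off `{2, 5, 7, 293}`; Heegner hypotheses for `N`, for `7` and for `31`
  by `d ≡ 1 (mod 8)` + Kronecker symbols (`X1.DoubleTwistDisplayKit.satisfiesHeegnerHypothesis_of_jacobiSym`).
NUMERICS OF RECORD (seat evidence `ROAD-E-P7-WITNESS-20510e1-w8g6.md` on -19033, mirror `HOME/line-x2-p1-w8-g6/`; method = w5 g5's `ROAD-E-P5-WITNESS-w5g5.md` §2): source =
x2-p1-w5 g5's local engine v2 (`cellp.py`: a_p by BSGS on #E(𝔽_p) ≡ 0 mod 7 to 4.4·10⁶, 27 random primes cross-checked against Legendre sums, 0 mismatches; exact twist models `twistdata.py`) RUN BY THIS SEAT (w8 g6), kit 0; TM = 3;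
path `(-31, -271)`, `D = 8401`, `N·D² = 1447530188510`: `L′(Wd,1) = 42.0936233`, `L(W″,1) = 5.153996089`, `#Ш_an(W″) = 1`.
HYPOTHESES LEFT, BY NAME: the v12 cone — `PublishedInputs` (item 19037), Wuthrich 2014 Prop. 21, Hsieh 2014 Thm. 1, LZZ 2018
Thms. 1.5.1/1.5.3, Mazur 1978 Cor. 4.1 (PUBLISHED), Keller–Yin Thm. D (PREPRINT) — and FOUR readings `hr`, `hrd`, `hL`, `hunit`;
Poitou–Tate ×2 discharged (bsd-schneider `_holds`). HONEST FRAMING: nothing is booked; `(20510e1, 7)` is NOT closed by this file; the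
named facts are typed for general `p` but were READ by their typists with the `p = 3` programme in view — whether each printed
hypothesis set covers `p = 7` at this pair is NOT re-audited here; Mazur's main conjecture / BSD is proved for NO curve; no summit
statement is proved; closes no registered stub; 0 cells / labels / stubs / tiers move. References: [Wuthrich2014] Thm. 16, Prop. 21;
[KellerYin2024] Thm. D (PRE); [LiuZhangZhang2018]; [Hsieh2014]; [Mazur1978] Cor. 4.1; [SilvermanATAEC1994] V.5.3–5.4;
[SilvermanAEC2009] III.2.3, VII.1, VII.5; [GrossLMS1991] §1; [Mazur1977] III.5.
-/
set_option autoImplicit false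
-- `Summit.BirchSwinnertonDyer.BirchSwinnertonDyer.…`: the summit and its single sub-problem share a name.
set_option linter.dupNamespace false
noncomputable section
open scoped Classical
open WeierstrassCurve NumberField IsDedekindDomain Literature.NumberTheory.EllipticCurves
  Literature.NumberTheory.EllipticCurves.ModularForms Literature.NumberTheory.EllipticCurves.Rank1Residual
  Literature.NumberTheory.EllipticCurves.Rank1Residual.Typed
  Literature.NumberTheory.EllipticCurves.Rank1Residual.X11RankOneCertificates
  Literature.NumberTheory.EllipticCurves.Wuthrich2014 Literature.NumberTheory.EllipticCurves.KellerYin2024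
  Literature.NumberTheory.EllipticCurves.TateCurve Literature.NumberTheory.GaloisCohomology
  Summit.BirchSwinnertonDyer.BirchSwinnertonDyer.Rank1Residual.IntModel
  Summit.BirchSwinnertonDyer.BirchSwinnertonDyer.Rank1Residual.X11RankOne
  Summit.BirchSwinnertonDyer.Rank1Residual.X11b Summit.BirchSwinnertonDyer.Rank1Residual
  Summit.BirchSwinnertonDyer.Rank1Residual.X2
  Summit.BirchSwinnertonDyer.Rank1Residual.X2.RouteGSplitDisplay329718a1Local
  Summit.BirchSwinnertonDyer.BirchSwinnertonDyer.Theses Summit.BirchSwinnertonDyer.BirchSwinnertonDyer.Theorems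
  Summit.BirchSwinnertonDyer.BirchSwinnertonDyer.Theorems.EisensteinPrimesMazurMCOnCellBTwistbackTwoStepShaUnit
  Summit.BirchSwinnertonDyer.BirchSwinnertonDyer.Theorems.EisensteinPrimesMazurMCOnCellBTwistbackTwoStepShaUnitLevel

namespace Summit.BirchSwinnertonDyer.BirchSwinnertonDyer.Theorems.EisensteinPrimesMazurMCOnCellBTwistbackUnitEndP7Cell20510e1
/-! ## §1 The base pair `(20510e1, 7)`: split at `7`, the rational point of order `7`, `E[7]` reducible, `¬ GVPar`, `X2.CellB`, good reduction off `{2, 5, 7, 293}`, Heegner for `N` -/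

/-- `20510e1 = [1, -1, 1, 9588, 2333199]` is elliptic (`|Δ| = 2⁷·5⁷·7⁷·293 ≠ 0`). [folklore] -/
theorem isElliptic_20510e1 : (⟨1, -1, 1, 9588, 2333199⟩ : WeierstrassCurve ℚ).IsElliptic :=
  isElliptic_of_discOf_ne_zero 1 (-1) 1 9588 2333199 (by decide +kernel)

set_option maxRecDepth 100000 in
/-- `20510e1` is globally minimal (support-form Kraus–Silverman criterion on `|Δ| = 2⁷·5⁷·7⁷·293`).
[cite: SilvermanAEC2009, VII.1 Remark 1.1] [cite: Kraus1989, Prop. 1 and Prop. 2] -/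
theorem isGloballyMinimal_20510e1 : (⟨1, -1, 1, 9588, 2333199⟩ : WeierstrassCurve ℚ).IsGloballyMinimal :=
  X11b.isGloballyMinimal_of_krausCriterion_support 1 (-1) 1 9588 2333199
    [(2, 1, 7), (5, 1, 7), (7, 1, 7), (293, 1, 1)] (by intro t ht; fin_cases ht <;> norm_num)
    (by decide +kernel) (by decide +kernel)

/-- **`20510e1` is SPLIT multiplicative at `7`** (`7 ∣ Δ`, `7 ∤ c₄ = -460239`; node-tangent root `t = 1` mod `7`).
[cite: SilvermanAEC2009, VII.5 Prop. 5.1(b)] -/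
theorem split_20510e1 : (⟨1, -1, 1, 9588, 2333199⟩ : WeierstrassCurve ℚ).HasSplitMultiplicativeReductionAtPrime 7 := by
  haveI := isElliptic_20510e1
  haveI := isGloballyMinimal_20510e1
  have hI := integralModelInt_eq_of_map_eq (W := (⟨1, -1, 1, 9588, 2333199⟩ : WeierstrassCurve ℚ)) _
    (map_mk_int 1 (-1) 1 9588 2333199)
  refine hasSplitMultiplicativeReductionAtPrime_of_intModel_of_root hI 7
    (by rw [intCurve_Δ]; decide +kernel) (by rw [intCurve_c₄]; decide +kernel) ⟨1, ?_⟩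
  simp only [WeierstrassCurve.c₄, WeierstrassCurve.b₂, WeierstrassCurve.b₄, WeierstrassCurve.b₆]
  push_cast
  decide

/-- **A rational point of ORDER `7` on `20510e1` — IN THE KERNEL**: `T = (57, 1721)`, `2T = (-83, -939)`, `4T = (407, 8371)`, `8T = T`
(three tangent certificates decided on the integer model; transport lemma of the 395c1 file; no torsion theorem named).
[cite: SilvermanAEC2009, III.2.3] -/
theorem exists_addOrderOf_eq_seven_20510e1 : ∃ T : (⟨1, -1, 1, 9588, 2333199⟩ : WeierstrassCurve ℚ).toAffine.Point, addOrderOf T = 7 := by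
  have hΔ : (⟨1, -1, 1, 9588, 2333199⟩ : WeierstrassCurve ℤ).Δ ≠ 0 := by rw [intCurve_Δ]; decide +kernel
  exact EisensteinPrimesMazurMCOnCellBTwistbackUnitEndP5Cell395c1.exists_addOrderOf_eq_of_curve_eq (map_mk_int 1 (-1) 1 9588 2333199)
    (EisensteinPrimesMazurMCOnCellBTwistbackUnitEndP7Cell546f1.exists_addOrderOf_eq_seven_of_intTangent (x₁ := 57) (y₁ := 1721) (x₂ := (-83)) (y₂ := (-939))
      (x₄ := 407) (y₄ := 8371) hΔ (by decide +kernel) (by decide +kernel) (by decide +kernel) (by decide +kernel)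
      (by decide +kernel) (by decide +kernel))

/-- **`20510e1[5]` is reducible — IN THE KERNEL** (a rational point of order `7` spans a Galois-stable line; Mazur's torsion–Galois
structure lemma of the tree, no named fact). [cite: Mazur1977, Ch. III §5, p. 157] -/
theorem not_irreducible_20510e1 : ¬ (⟨1, -1, 1, 9588, 2333199⟩ : WeierstrassCurve ℚ).HasIrreducibleModPGaloisRep 7 := by
  haveI := isElliptic_20510e1
  obtain ⟨T, hT⟩ := exists_addOrderOf_eq_seven_20510e1
  exact not_hasIrreducibleModPGaloisRep_of_addOrderOf_eq _ hT

/-- **`¬ GVPar (20510e1) 5` IN THE KERNEL**: the rational `7`-torsion point spans a rational line that is unramified at `7` and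
even, hence of co-type, and at the odd SPLIT multiplicative prime `7` one co-type line forces type A
(`X2.not_gvPar_of_nsmul_eq_zero_of_mult`, Tate uniformisation `hT`, `hT'`; same shape as the `p = 3` displays).
[cite: GreenbergVatsal2000, Thm. (1.3) and §2 p. 28] [cite: SilvermanATAEC1994, Thm. V.5.3 and Cor. V.5.4] -/
theorem not_gvPar_20510e1
    (hT : Silverman1994_thmV53_corV54_tateUniformisation.{0})
    (hT' : Silverman1994_thmV53_tateUniformisation.{0}) :
    ¬ GVPar (⟨1, -1, 1, 9588, 2333199⟩ : WeierstrassCurve ℚ) 7 := by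
  haveI := isElliptic_20510e1
  haveI := isGloballyMinimal_20510e1
  obtain ⟨T, hT5⟩ := exists_addOrderOf_eq_seven_20510e1
  have h5 : (7 : ℕ) • T = 0 := hT5 ▸ addOrderOf_nsmul_eq_zero T
  have h0 : T ≠ 0 := by
    rintro rfl
    rw [addOrderOf_zero] at hT5
    exact absurd hT5 (by norm_num)
  exact not_gvPar_of_nsmul_eq_zero_of_mult _ hT' hT (by decide) split_20510e1.hasMultiplicativeReductionAtPrime _ h0 h5

/-- **`X2.CellB (20510e1) 5` from the rank reading alone**: `7 ≠ 2`, `E[7]` reducible (`not_irreducible_20510e1`), `7` multiplicative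
(`split_20510e1`), `¬ GVPar` (`not_gvPar_20510e1`, the Tate-uniformisation facts discharged by the tree's `_holds` theorems).
[cite: GreenbergVatsal2000, Thm. (1.3) and §2 p. 28] [cite: SilvermanATAEC1994, Thm. V.5.3 and Cor. V.5.4] -/
theorem cellB_20510e1_of_analyticRank
    (hr : (⟨1, -1, 1, 9588, 2333199⟩ : WeierstrassCurve ℚ).analyticRank = 0) :
    X2.CellB (⟨1, -1, 1, 9588, 2333199⟩ : WeierstrassCurve ℚ) 7 :=
  ⟨hr, ⟨by decide, not_irreducible_20510e1, split_20510e1.hasMultiplicativeReductionAtPrime⟩,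
    not_gvPar_20510e1 Silverman1994_thmV53_corV54_tateUniformisation_holds
      Silverman1994_thmV53_tateUniformisation_holds⟩

/-- The primes dividing `|Δ(20510e1)| = 2⁷·5⁷·7⁷·293` are `2, 5, 7, 293`. [folklore] -/
private theorem eq_of_prime_dvd_disc {q : ℕ} (hq : q.Prime) (h : q ∣ 2 ^ 7 * 5 ^ 7 * 7 ^ 7 * 293 ^ 1) :
    q = 2 ∨ q = 5 ∨ q = 7 ∨ q = 293 := by
  have hp : ∀ {r n : ℕ}, r.Prime → q ∣ r ^ n → q = r := fun hr hd ↦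
    (Nat.prime_dvd_prime_iff_eq hq hr).mp (hq.dvd_of_dvd_pow hd)
  rcases (Nat.Prime.dvd_mul hq).mp h with h | h293
  swap
  · exact Or.inr (Or.inr (Or.inr (hp (by norm_num) h293)))
  rcases (Nat.Prime.dvd_mul hq).mp h with h | h7
  swap
  · exact Or.inr (Or.inr (Or.inl (hp (by norm_num) h7)))
  rcases (Nat.Prime.dvd_mul hq).mp h with h | h5
  swap
  · exact Or.inr (Or.inl (hp Nat.prime_five h5))
  exact Or.inl (hp Nat.prime_two h)

/-- **Good reduction of `20510e1` at every prime `q ∉ {2, 5, 7, 293}`** (`|Δ| = 2⁷·5⁷·7⁷·293`).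
[cite: SilvermanAEC2009, VII.5 Prop. 5.1(a)] -/
theorem hasGoodReductionAtPrime_20510e1 (q : ℕ) [hq : Fact q.Prime]
    (h2 : q ≠ 2) (h5 : q ≠ 5) (h7 : q ≠ 7) (h293 : q ≠ 293) :
    (⟨1, -1, 1, 9588, 2333199⟩ : WeierstrassCurve ℚ).HasGoodReductionAtPrime q := by
  obtain ⟨v, hv⟩ : ∃ v : HeightOneSpectrum (𝓞 ℚ), (Rat.HeightOneSpectrum.primesEquiv v : ℕ) = q :=
    ⟨Rat.HeightOneSpectrum.primesEquiv.symm ⟨q, hq.out⟩, by rw [Equiv.apply_symm_apply]⟩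
  subst hv
  have hΔ : ¬ ((Rat.HeightOneSpectrum.primesEquiv v : ℕ) : ℤ) ∣
      (⟨1, -1, 1, 9588, 2333199⟩ : WeierstrassCurve ℤ).Δ := by
    intro h
    rw [intCurve_Δ, Int.natCast_dvd] at h
    have habs : (discOf [1, -1, 1, 9588, 2333199]).natAbs = 2 ^ 7 * 5 ^ 7 * 7 ^ 7 * 293 ^ 1 := by
      decide +kernel
    rcases eq_of_prime_dvd_disc hq.out (habs ▸ h) with h | h | h | h
    · exact h2 h
    · exact h5 h
    · exact h7 h
    · exact h293 h
  have hg := hasGoodReductionAt_map_of_not_dvd _ v hΔ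
  rw [map_mk_int] at hg
  exact (hasGoodReductionAtPrime_iff_hasGoodReductionAt_ringOfIntegers v _).2 hg

/-- **Heegner hypothesis for `N_{20510e1}` in a quadratic field from `d_K ≡ 1 (mod 8)` and Kronecker symbols at `5, 7, 293`** — no conductor
reading: a prime dividing the conductor is a prime of bad reduction (`dvd_conductorNorm_iff_not_hasGoodReductionAtPrime`), hence one
of `2, 5, 7, 293` (`hasGoodReductionAtPrime_20510e1`). [cite: GrossLMS1991, §1 (p. 235)] [cite: SilvermanAEC2009, VII.5 Prop. 5.1(a)] -/
theorem satisfiesHeegnerHypothesis_conductorNorm_20510e1 {K : Type} [Field K] [NumberField K]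
    (h2 : Module.finrank ℚ K = 2) (h8 : NumberField.discr K % 8 = 1) (h5 : jacobiSym (NumberField.discr K) 5 = 1) (h7 : jacobiSym (NumberField.discr K) 7 = 1) (h293 : jacobiSym (NumberField.discr K) 293 = 1) :
    SatisfiesHeegnerHypothesis ((⟨1, -1, 1, 9588, 2333199⟩ : WeierstrassCurve ℚ).conductorNorm ℤ) K := by
  haveI := isElliptic_20510e1
  refine (satisfiesHeegnerHypothesis_iff_kronecker _ K h2).mpr fun p hp hpN ↦ ?_
  haveI : Fact p.Prime := ⟨hp⟩
  have hbad : ¬ (⟨1, -1, 1, 9588, 2333199⟩ : WeierstrassCurve ℚ).HasGoodReductionAtPrime p :=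
    (WeierstrassCurve.dvd_conductorNorm_iff_not_hasGoodReductionAtPrime _ p).mp hpN
  by_cases hp2 : p = 2
  · subst hp2; exact ⟨fun _ ↦ h8, fun h ↦ absurd rfl h⟩
  by_cases hp5 : p = 5
  · subst hp5; exact ⟨fun h ↦ absurd h (by norm_num), fun _ ↦ h5⟩
  by_cases hp7 : p = 7
  · subst hp7; exact ⟨fun h ↦ absurd h (by norm_num), fun _ ↦ h7⟩
  by_cases hp293 : p = 293
  · subst hp293; exact ⟨fun h ↦ absurd h (by norm_num), fun _ ↦ h293⟩
  exact absurd (hasGoodReductionAtPrime_20510e1 p hp2 hp5 hp7 hp293) hbad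

end Summit.BirchSwinnertonDyer.BirchSwinnertonDyer.Theorems.EisensteinPrimesMazurMCOnCellBTwistbackUnitEndP7Cell20510e1
end
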